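import Summits.SmoothPoincare4.SmoothPoincare4.Theorems.SoloInformedGabaiPoincareBalls
import Literature.Topology.FourManifolds.CorkDecomposition
import HarnessLib
import HarnessLib.Audit.Tags

/-!
# Gabai (2022), §13 — the Poénaru deduction "Conjecture 13.4 ⇒ Conjecture 13.1", kernel-checked

Host summit `SmoothPoincare4` (soloist seat `solo-SmoothPoincare4-informed`).  This file proves, over
the typed obligations of `SoloInformedGabaiPoincareBalls.lean`, the implication that Gabai records as
*"Here is a classical approach to Conjecture 13.1, which we first learned from Valentin Poénaru"*
(D. Gabai, *3-Spheres in the 4-Sphere and Pseudo-Isotopies of `S¹ × S³`*, arXiv:2212.02004v2, §13,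
p. 62, Conjecture 13.4 and Remarks 13.2 (i)):

* `poincareBallDoubleConjecture_of_thickening` — **13.4 (i) [thickening form] ∧ 13.4 (ii) ⇒ 13.1
  [double form]**: if every double `D(Δ)` of a Poincaré 4-ball bounds a compact contractible
  5-dimensional 2-handlebody `V` (`PoincareBallDoubleBoundsTwoHandlebody`) and every such `V` is the
  5-ball (`ContractibleTwoHandlebodyFiveIsBall`), then `D(Δ) ≅ ∂V ≅ ∂𝔻⁵ = S⁴`
  (`PoincareBallDoubleConjecture`).  The last step is the restriction of the diffeomorphism
  `V ≅ 𝔻⁵` to boundary data (`BoundaryData.restrictDiffeomorph`, `CorkDecomposition.lean`; Lee,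
  *Introduction to Smooth Manifolds* (2013), Thm. 5.11, Cor. 5.30) with `∂𝔻⁵ = 𝕊⁴`
  (`closedBallBoundaryData`, `ClosedBall.lean`).
* `poincareBallDoubleConjecture_of_isTwoHandlebody` — the same from the STRONG form of 13.4 (i)
  (Remarks 13.5: `Δ` itself is a 2-handlebody, `PoincareBallIsTwoHandlebody`), through the tree's
  thickening fact `exists_thickening_of_isDouble` (`∂(Δ × I) = D(Δ)`, FGMW 2010, proof of Fact 2).
* `poincareBallEmbeddingConjecture_of_isTwoHandlebody` — composing with
  `poincareBallEmbeddingConjecture_of_doubleConjecture`: the Poénaru programme, if completed, gives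
  the Poincaré ball embedding conjecture (every Poincaré ball is a Schoenflies ball), which together
  with the Schoenflies conjecture gives SPC4 (Gabai, §13 p. 62).

No new mathematics: elementary logic over the tree's vocabulary; every open statement enters as a
hypothesis.  [cite: Gabai2022, §13 p. 62: Conj. 13.1, Remarks 13.2 (i), Conj. 13.4, Remarks 13.5]

## References

* D. Gabai, *3-Spheres in the 4-Sphere and Pseudo-Isotopies of `S¹ × S³`*, arXiv:2212.02004v2
  (2024), §13, p. 62.
* J. M. Lee, *Introduction to Smooth Manifolds*, 2nd ed. (2013), Thm. 5.11, Cor. 5.30.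
-/

noncomputable section

open scoped Manifold ContDiff Topology
open Set Function

namespace Summit.SmoothPoincare4.SmoothPoincare4.Theorems

open Literature.Topology.FourManifolds

/-- **Poénaru's deduction, 13.4 ⇒ 13.1** (Gabai 2022, §13 p. 62, in the typed forms of
`SoloInformedGabaiPoincareBalls.lean`): if every double of a Poincaré 4-ball bounds a compact
contractible 5-dimensional 2-handlebody, and compact contractible 5-dimensional 2-handlebodies are
5-balls, then every double of a Poincaré 4-ball is diffeomorphic to `S⁴`.  Proof: the boundary
embedding `φ : P ↪ V` onto `∂V` is a boundary datum of `V` with carrier `P`; restrict the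
diffeomorphism `V ≅ 𝔻⁵` to boundary data, `∂𝔻⁵ = 𝕊⁴`. [cite: Gabai2022, Conj. 13.4 and
Remarks 13.2 (i)] -/
theorem poincareBallDoubleConjecture_of_thickening
    (h₁ : PoincareBallDoubleBoundsTwoHandlebody) (h₂ : ContractibleTwoHandlebodyFiveIsBall) :
    PoincareBallDoubleConjecture := by
  intro W _ _ _ _ _ _ _ b hb P _ _ _ _ _ hP
  obtain ⟨V, _, _, _, _, _, _, hcontr, hV, φ, hφ, hrange⟩ := h₁ W b hb P hP
  haveI := hcontr
  obtain ⟨ψ⟩ := h₂ V hV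
  let bV : BoundaryData (𝓡∂ (3 + 1 + 1)) V (𝓡 (3 + 1)) :=
    { carrier := P, incl := φ, isSmoothEmbedding := hφ, range_incl := hrange }
  exact ⟨bV.restrictDiffeomorph (closedBallBoundaryData (3 + 1)) ψ⟩

/-- **The Poénaru programme from the strong form**: Remarks 13.5 (a Poincaré ball is itself a
2-handlebody) and Conjecture 13.4 (ii), together with the tree's thickening fact
`exists_thickening_of_isDouble` (`∂(Δ × I) = D(Δ)` is the boundary of a 2-handlebody thickening),
give Conjecture 13.1 in double form. [cite: Gabai2022, Remarks 13.5 and Conj. 13.4 (ii)] -/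
theorem poincareBallDoubleConjecture_of_isTwoHandlebody (h₁ : PoincareBallIsTwoHandlebody)
    (hT : exists_thickening_of_isDouble) (h₂ : ContractibleTwoHandlebodyFiveIsBall) :
    PoincareBallDoubleConjecture :=
  poincareBallDoubleConjecture_of_thickening (doubleBoundsTwoHandlebody_of_isTwoHandlebody h₁ hT) h₂

/-- **The Poénaru programme reaches the Poincaré ball embedding conjecture**: Remarks 13.5 ∧
Conjecture 13.4 (ii) (with the tree's thickening and gluing-existence facts) imply that every
Poincaré 4-ball embeds in `S⁴`, i.e. is a Schoenflies ball — which with the Schoenflies conjecture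
gives SPC4 (Gabai 2022, §13 p. 62). [cite: Gabai2022, §13 p. 62] -/
theorem poincareBallEmbeddingConjecture_of_isTwoHandlebody (h₁ : PoincareBallIsTwoHandlebody)
    (hT : exists_thickening_of_isDouble) (h₂ : ContractibleTwoHandlebodyFiveIsBall)
    (hG : ∀ (W : Type) [TopologicalSpace W] [T2Space W] [SecondCountableTopology W]
      [ChartedSpace (EuclideanHalfSpace (3 + 1)) W] [IsManifold (𝓡∂ (3 + 1)) ∞ W]
      [CompactSpace W] (b : BoundaryData (𝓡∂ (3 + 1)) W (𝓡 3)), exists_isBoundaryGluing b b) :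
    PoincareBallEmbeddingConjecture :=
  poincareBallEmbeddingConjecture_of_doubleConjecture hG
    (poincareBallDoubleConjecture_of_isTwoHandlebody h₁ hT h₂)

end Summit.SmoothPoincare4.SmoothPoincare4.Theorems
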